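import Summits.ValiantsHypothesis.ValiantsHypothesis.Theorems.FreeSubtorusSubtorusCoveringStubIndepMatching
import HarnessLib

/-!
# `FreeSubtorus.OrbitDimensionBound` (stmt-ValiantsHypothesis-16133), line `affine_multiple`, stub
# `stub_absorbingSacrifice`: the maximum independent matching WITH ITS INDEPENDENCE EXPORTED

The floor's `stub_indepMatching` (`…FreeSubtorusSubtorusCoveringStubIndepMatching.lean`, crux 16134)
returns a partial matching `(ι, κ)` of the row/column characters of `Λ` together with the SPANNING
property (every column of `Λ`, times one `N > 0`, is an integer combination of the matched
differences), but forgets that the matching was chosen of MAXIMUM size among those with linearly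
INDEPENDENT differences.  The composition of `stub_absorbingSacrifice` (branch (β): re-match or
rigid, `…StubAbsorbingSacrificeRematch.lean`) needs exactly that: `rematch_or_rigid` /
`linearIndependent_update_of_not_mem_span` are stated for an independent matching and its failed
augmentations.  `indepMatching_independent` below is `stub_indepMatching` with the two extra
conjuncts — linear independence over `ℚ` of `t ↦ (Λ · (inl (ι t)) - Λ · (inr (κ t)))` in `Fin r → ℚ`
and maximality (`no matching of size s + 1 is independent`) — and the same spanning clauses
(same proof: `indepMatching_span` by name, zero row-sums, clearing denominators).
Helper of the item (`--supports stmt-ValiantsHypothesis-16133 --as helper`; 0 definitions / 0 named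
facts).  Honest framing: plumbing; `stub_absorbingSacrifice`, the crux and `VP ≠ VNP` remain OPEN.
-/

set_option linter.dupNamespace false

namespace Summit.ValiantsHypothesis.ValiantsHypothesis.Theorems.FreeSubtorusSubtorusCovering

open Finset Submodule

/-- **Maximum independent matching, exported.**  For `Λ : Fin r → (Fin n ⊕ Fin n) → ℤ` with zero
row-sums there are `s ≤ r` and injections `ι κ : Fin s ↪ Fin n` whose differences
`t ↦ Λ(·)(inl (ι t)) - Λ(·)(inr (κ t))` are linearly independent over `ℚ`, such that no matching of
size `s + 1` has independent differences, and either `n ≤ s + 2` or, for one `N > 0`, every column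
`N • Λ(·)(inl k)`, `N • Λ(·)(inr l)` is an integer combination of the matched differences.
[folklore] -/
theorem indepMatching_independent :
    ∀ (n r : ℕ) (Λ : Fin r → (Fin n ⊕ Fin n) → ℤ),
    (∀ i, (∑ k, Λ i (Sum.inl k)) = 0) →
    ∃ (s : ℕ) (ι κ : Fin s ↪ Fin n), s ≤ r ∧
      LinearIndependent ℚ (fun (t : Fin s) (i : Fin r) =>
        ((Λ i (Sum.inl (ι t)) : ℚ) - (Λ i (Sum.inr (κ t)) : ℚ))) ∧
      (∀ ι' κ' : Fin (s + 1) ↪ Fin n, ¬ LinearIndependent ℚ (fun (t : Fin (s + 1)) (i : Fin r) =>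
        ((Λ i (Sum.inl (ι' t)) : ℚ) - (Λ i (Sum.inr (κ' t)) : ℚ)))) ∧
      (n ≤ s + 2 ∨
        ∃ N : ℕ, 0 < N ∧
          (∀ k : Fin n, ∃ a : Fin s → ℤ, ∀ i,
            (N : ℤ) * Λ i (Sum.inl k) =
              ∑ j, a j * (Λ i (Sum.inl (ι j)) - Λ i (Sum.inr (κ j)))) ∧
          (∀ l : Fin n, ∃ a : Fin s → ℤ, ∀ i,
            (N : ℤ) * Λ i (Sum.inr l) =
              ∑ j, a j * (Λ i (Sum.inl (ι j)) - Λ i (Sum.inr (κ j))))) := by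
  intro n r Λ hrow
  classical
  -- the columns of `Λ` over `ℚ`
  let a : Fin n → (Fin r → ℚ) := fun k i => (Λ i (Sum.inl k) : ℚ)
  let b : Fin n → (Fin r → ℚ) := fun l i => (Λ i (Sum.inr l) : ℚ)
  -- independent matchings and a maximum one
  let P : ℕ → Prop := fun s => ∃ ι κ : Fin s ↪ Fin n, LinearIndependent ℚ (fun t => a (ι t) - b (κ t))
  have hP0 : P 0 :=
    ⟨Function.Embedding.ofIsEmpty, Function.Embedding.ofIsEmpty, linearIndependent_empty_type⟩
  have hPb : ∀ s, P s → s ≤ r := by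
    rintro s ⟨ι, κ, h⟩
    have := h.fintype_card_le_finrank
    simpa using this
  obtain ⟨s, ⟨ι, κ, hw⟩, hmax⟩ : ∃ s, P s ∧ ∀ s', P s' → s' ≤ s :=
    ⟨Nat.findGreatest P r, Nat.findGreatest_spec (P := P) (Nat.zero_le r) hP0,
      fun s' hs' => Nat.le_findGreatest (hPb s' hs') hs'⟩
  have hmax' : ∀ ι' κ' : Fin (s + 1) ↪ Fin n, ¬ LinearIndependent ℚ (fun t => a (ι' t) - b (κ' t)) :=
    fun ι' κ' h => absurd (hmax (s + 1) ⟨ι', κ', h⟩) (by omega)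
  refine ⟨s, ι, κ, hPb s ⟨ι, κ, hw⟩, hw, hmax', ?_⟩
  by_cases hdeg : n ≤ s + 2
  · exact Or.inl hdeg
  right
  set w : Fin s → (Fin r → ℚ) := fun t => a (ι t) - b (κ t) with hwdef
  set S : Submodule ℚ (Fin r → ℚ) := span ℚ (Set.range w) with hS
  have hspan : ∀ k l, a k - b l ∈ S := indepMatching_span a b ι κ hw hmax' (by omega)
  -- zero row-sums: every column lies in `S`
  have hn0 : (n : ℚ) ≠ 0 := by exact_mod_cast (show n ≠ 0 by omega)
  let l₀ : Fin n := ⟨0, by omega⟩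
  have hsum0 : ∑ k, a k = 0 := by
    funext i
    rw [Finset.sum_apply]
    simp only [a, Pi.zero_apply]
    exact_mod_cast hrow i
  have ha : ∀ k, a k ∈ S := by
    intro k
    have hsum : (n : ℚ) • a k = ∑ k', (a k - a k') := by
      rw [Finset.sum_sub_distrib, hsum0, sub_zero, Finset.sum_const, card_univ, Fintype.card_fin,
        Nat.cast_smul_eq_nsmul]
    have hmem : (n : ℚ) • a k ∈ S := by
      rw [hsum]
      refine S.sum_mem fun k' _ => ?_
      have : a k - a k' = (a k - b l₀) - (a k' - b l₀) := by abel
      rw [this]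
      exact S.sub_mem (hspan k l₀) (hspan k' l₀)
    have := S.smul_mem (n : ℚ)⁻¹ hmem
    rwa [smul_smul, inv_mul_cancel₀ hn0, one_smul] at this
  have hb : ∀ l, b l ∈ S := fun l => by
    have : b l = a l₀ - (a l₀ - b l) := by abel
    rw [this]
    exact S.sub_mem (ha l₀) (hspan l₀ l)
  -- coordinates and a common denominator
  have hcoef : ∀ x ∈ S, ∃ c : Fin s → ℚ, x = ∑ t, c t • w t := fun x hx => by
    obtain ⟨c, hc⟩ := (Submodule.mem_span_range_iff_exists_fun ℚ).1 hx
    exact ⟨c, hc.symm⟩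
  choose ca hca using fun k => hcoef (a k) (ha k)
  choose cb hcb using fun l => hcoef (b l) (hb l)
  set N : ℕ := (∏ k, ∏ t, (ca k t).den) * ∏ l, ∏ t, (cb l t).den with hN
  have hNpos : 0 < N := by
    refine Nat.pos_of_ne_zero ?_
    simp only [hN, mul_ne_zero_iff, Finset.prod_ne_zero_iff]
    exact ⟨fun k _ t _ => (ca k t).den_nz, fun l _ t _ => (cb l t).den_nz⟩
  -- evaluation of a coordinate expansion at `i`
  have heval : ∀ (x : Fin r → ℚ) (c : Fin s → ℚ), x = ∑ t, c t • w t → ∀ i,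
      (N : ℚ) * x i = ∑ t, ((N : ℚ) * c t) *
        ((Λ i (Sum.inl (ι t)) : ℚ) - (Λ i (Sum.inr (κ t)) : ℚ)) := by
    intro x c hx i
    rw [hx, Finset.sum_apply, Finset.mul_sum]
    refine Finset.sum_congr rfl fun t _ => ?_
    simp only [Pi.smul_apply, hwdef, Pi.sub_apply, smul_eq_mul, a, b]
    ring
  -- clearing one coordinate vector
  have hclear : ∀ c : Fin s → ℚ, (∀ t, (c t).den ∣ N) →
      ∃ z : Fin s → ℤ, ∀ t, ((z t : ℤ) : ℚ) = (N : ℚ) * c t := by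
    intro c hc
    refine ⟨fun t => ((N / (c t).den : ℕ) : ℤ) * (c t).num, fun t => ?_⟩
    obtain ⟨m, hm⟩ := hc t
    have hden : (c t).den ≠ 0 := (c t).den_nz
    have hdiv : N / (c t).den = m := by
      rw [hm, Nat.mul_div_cancel_left _ (Nat.pos_of_ne_zero hden)]
    dsimp only
    rw [hdiv]
    push_cast
    rw [hm]
    push_cast
    rw [← Rat.mul_den_eq_num (c t)]
    ring
  refine ⟨N, hNpos, fun k => ?_, fun l => ?_⟩
  · have hdvd : ∀ t, (ca k t).den ∣ N := fun t =>
      ((Finset.dvd_prod_of_mem (fun t => (ca k t).den) (mem_univ t)).trans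
        (Finset.dvd_prod_of_mem (fun k => ∏ t, (ca k t).den) (mem_univ k))).mul_right _
    obtain ⟨z, hz⟩ := hclear (ca k) hdvd
    refine ⟨z, fun i => ?_⟩
    have key := heval (a k) (ca k) (hca k) i
    have : ((((N : ℤ) * Λ i (Sum.inl k) : ℤ)) : ℚ) =
        ((∑ j, z j * (Λ i (Sum.inl (ι j)) - Λ i (Sum.inr (κ j))) : ℤ) : ℚ) := by
      push_cast
      rw [key]
      refine Finset.sum_congr rfl fun t _ => ?_
      rw [hz t]
    exact_mod_cast this
  · have hdvd : ∀ t, (cb l t).den ∣ N := fun t =>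
      ((Finset.dvd_prod_of_mem (fun t => (cb l t).den) (mem_univ t)).trans
        (Finset.dvd_prod_of_mem (fun l => ∏ t, (cb l t).den) (mem_univ l))).mul_left _
    obtain ⟨z, hz⟩ := hclear (cb l) hdvd
    refine ⟨z, fun i => ?_⟩
    have key := heval (b l) (cb l) (hcb l) i
    have : ((((N : ℤ) * Λ i (Sum.inr l) : ℤ)) : ℚ) =
        ((∑ j, z j * (Λ i (Sum.inl (ι j)) - Λ i (Sum.inr (κ j))) : ℤ) : ℚ) := by
      push_cast
      rw [key]
      refine Finset.sum_congr rfl fun t _ => ?_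
      rw [hz t]
    exact_mod_cast this

end Summit.ValiantsHypothesis.ValiantsHypothesis.Theorems.FreeSubtorusSubtorusCovering
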